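import Summits.AtomisticToContinuum.HydrodynamicLimit.Theorems.InformationPercolationEngineChaosClosesEulerEntropyBalanceF
import HarnessLib

/-!
# Windowed entropy balance — helper G: collision bookkeeping and Abel summation along the orbit

Helper file for the registered stub `stub_windowedEntropyBalance` of the line `empirical-h-theorem`
(crux `InformationPercolationEngine.ChaosClosesEuler`, stmt-AtomisticToContinuum-15141).

WHAT. The trajectory-level steps of the windowed entropy balance: (1) Bogolyubov's bookkeeping at one
collision for particle-dependent marks (`pairSum_eq_particleSum'`: the ordered-contact-pair sum of
`T i (vᵢ⁻)` is the particle sum of `T i` at the left-limit velocities) and the data of the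
pre-collisional configuration (`collision_data`); (2) the per-collision estimate
(`collision_step`): the pair sum of the tent-weighted windowed entropic marks is
`b (N+1)(𝒮(γ(s⁻)) − 𝒮(γ(s)))` up to `b (3/(πr³)) C_h C_R⁰/(2(N+1))` times the quartic pair sum
(helper E); (3) Abel summation with drift (`abel_drift_bound`) and its application along the
increasing enumeration of the collision times of `[0, τ]` (`orbit_abel_bound`): with
`|𝒮| ≤ C_B(1 + E/(N+1))` (helper C, energy conservation), the free-flight drift
`≤ C_L(1+E/(N+1))² Δt` (helper F) and the `r⁻¹`-bounded, `r⁻²`-Lipschitz tent,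
`|Σ_s bt(s − t₀)(𝒮(γ(s⁻)) − 𝒮(γ(s)))| ≤ C₁ (1 + E/(N+1))²`, `C₁ = 2C_B/r + C_Bτ/r² + C_Lτ/r`.

References: N. N. Bogolyubov (1975) (bookkeeping of the empirical collision term); folklore.
Template: the landed `ChaosClosesEulerCollisionInvariance` (p98069).
-/

noncomputable section

namespace Summit.AtomisticToContinuum.HydrodynamicLimit.Theorems.ChaosClosesEulerEntropyBalance

open scoped BigOperators Topology Classical MeasureTheory ENNReal InnerProductSpace
open Filter Set MeasureTheory
open Literature.MathematicalPhysics.KineticTheory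
open Literature.Analysis.FluidPDE
open Summit.AtomisticToContinuum.HydrodynamicLimit.Theorems.LocalSecondLawNegative (cone rhoC cone_nonneg
  continuous_cone rhoC_nonneg continuous_rhoC)
open Summit.AtomisticToContinuum.HydrodynamicLimit.Theorems.ChaosClosesEulerWindowedInvariance (cone_nonneg_le
  tent_nonneg_le abs_tent_sub_tent_le)
open Summit.AtomisticToContinuum.HydrodynamicLimit.Theorems.ChaosClosesEulerCollisionInvariance (abel_bound)

/-! ## §1 Bookkeeping at one collision -/

/-- **Bogolyubov's bookkeeping at one collision, for particle-dependent marks.** At a collision time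
of a hard-sphere trajectory in a regular geometry, for marks `T i` vanishing at the current velocity
of `i`, the ordered-contact-pair sum of `T i (vᵢ⁻)` (recorded pre-collisional velocity) is the sum
over ALL particles of `T i` at the left-limit velocity. [folklore] -/
theorem pairSum_eq_particleSum' {d : Type*} [Fintype d] {X : Type*} [TopologicalSpace X] [T2Space X]
    {n : ℕ} {G : Geometry d X} {ε : ℝ} {γ : ℝ → Config n d X} (h : IsHardSphereTrajectory G ε n γ)
    (hG : G.IsHardSphereRegular ε) {s : ℝ} (hs : s ∈ collisionTimes G ε γ)
    (T : Fin n → EuclideanSpace ℝ d → ℝ) (hT : ∀ i, T i (γ s i).2 = 0) :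
    (∑ i, ∑ j, if i ≠ j ∧ ‖G.sepVec (γ s i).1 (γ s j).1‖ = ε then
        T i (reflectVel (G.sepVec (γ s i).1 (γ s j).1) ((γ s i).2, (γ s j).2)).1 else 0) =
      ∑ i, T i (Function.leftLim γ s i).2 := by
  obtain ⟨⟨p, q⟩, hpq⟩ := mem_collisionTimes_iff_contactPairs_nonempty.1 hs
  have hne : p ≠ q := (mem_contactPairs.1 hpq).1
  have hc : γ s ∈ contactSet G n ε p q := (mem_contactPairs.1 hpq).2
  have hqp : (q, p) ∈ contactPairs G ε (γ s) := (swap_mem_contactPairs_iff hG).2 hpq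
  have hc' : γ s ∈ contactSet G n ε q p := (mem_contactPairs.1 hqp).2
  have hL : Function.leftLim γ s = collidePair G p q (γ s) := h.leftLim_eq_collidePair hne hc
  have hL' : Function.leftLim γ s = collidePair G q p (γ s) := h.leftLim_eq_collidePair hne.symm hc'
  have hne2 : ((p, q) : Fin n × Fin n) ≠ (q, p) := fun heq => hne (Prod.mk.inj heq).1
  rw [← sum_contactPairs_eq (h.mem s), h.contactPairs_eq_pair hG hpq, Finset.sum_pair hne2]
  have hrest : ∀ k, k ≠ p ∧ k ≠ q → T k (Function.leftLim γ s k).2 = 0 :=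
    fun k hk => by rw [hL, collidePair_apply_of_ne hk.1 hk.2, hT]
  rw [Fintype.sum_eq_add p q hne hrest]
  congr 1
  · rw [hL, collidePair_apply_left hne]
  · rw [hL', collidePair_apply_left hne.symm]

/-- At a collision time the pre-collisional configuration has the same positions, the same velocities
off the colliding pair `{p, q}`, and the same pair kinetic energy; and the quartic pair sum at that
time is `2(1 + |v_p|⁴ + |v_q|⁴)`. [folklore] -/
theorem collision_data {N : ℕ} {G : Geometry (Fin 3) T3} {ε : ℝ} {γ : ℝ → Config (N + 1) (Fin 3) T3}
    (h : IsHardSphereTrajectory G ε (N + 1) γ) (hG : G.IsHardSphereRegular ε) {s : ℝ}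
    (hs : s ∈ collisionTimes G ε γ) :
    ∃ p q : Fin (N + 1), p ≠ q ∧ (∀ k, (Function.leftLim γ s k).1 = (γ s k).1) ∧
      (∀ k, k ≠ p → k ≠ q → (Function.leftLim γ s k).2 = (γ s k).2) ∧
      ‖(Function.leftLim γ s p).2‖ ^ 2 + ‖(Function.leftLim γ s q).2‖ ^ 2 = ‖(γ s p).2‖ ^ 2 + ‖(γ s q).2‖ ^ 2 ∧
      configEnergy (Function.leftLim γ s) = configEnergy (γ s) ∧
      (∑ i, ∑ j, if i ≠ j ∧ ‖G.sepVec (γ s i).1 (γ s j).1‖ = ε then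
          1 + ‖(γ s i).2‖ ^ 4 + ‖(γ s j).2‖ ^ 4 else 0) = 2 * (1 + ‖(γ s p).2‖ ^ 4 + ‖(γ s q).2‖ ^ 4) := by
  obtain ⟨⟨p, q⟩, hpq⟩ := mem_collisionTimes_iff_contactPairs_nonempty.1 hs
  have hne : p ≠ q := (mem_contactPairs.1 hpq).1
  have hc : γ s ∈ contactSet G (N + 1) ε p q := (mem_contactPairs.1 hpq).2
  have hL : Function.leftLim γ s = collidePair G p q (γ s) := h.leftLim_eq_collidePair hne hc
  have hne2 : ((p, q) : Fin (N + 1) × Fin (N + 1)) ≠ (q, p) := fun heq => hne (Prod.mk.inj heq).1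
  refine ⟨p, q, hne, fun k => by rw [hL, collidePair_apply_fst], fun k hkp hkq => by
    rw [hL, collidePair_apply_of_ne hkp hkq], ?_, by rw [hL, configEnergy_collidePair hne], ?_⟩
  · rw [hL, collidePair_apply_left hne, collidePair_apply_right]
    exact norm_sq_reflectVel_fst_add_norm_sq_reflectVel_snd _ _
  · rw [← sum_contactPairs_eq (h.mem s), h.contactPairs_eq_pair hG hpq, Finset.sum_pair hne2]
    ring

/-! ## §2 Abel summation with drift -/

/-- **Abel summation with drift.** For a Stieltjes-type sum `Σ_{c ≤ M} g_c (f_c − f⁻_c)` with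
`|g| ≤ A`, `|f|, |f⁻_0| ≤ B`, increments `|g_{c+1} − g_c| ≤ L_q Δt_c` and drifts
`|f⁻_{c+1} − f_c| ≤ L_d Δt_c` (`Δt_c = t_{c+1} − t_c`): the sum is at most
`2AB + (B L_q + A L_d)(t_M − t_0)`. [folklore] -/
theorem abel_drift_bound (g f fpre t : ℕ → ℝ) {A B Lq Ld : ℝ} (hA : 0 ≤ A) (hB : 0 ≤ B) (M : ℕ)
    (hg : ∀ c, |g c| ≤ A) (hf : ∀ c, |f c| ≤ B) (hfpre0 : |fpre 0| ≤ B)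
    (hginc : ∀ c, c < M → |g (c + 1) - g c| ≤ Lq * (t (c + 1) - t c))
    (hdrift : ∀ c, c < M → |fpre (c + 1) - f c| ≤ Ld * (t (c + 1) - t c)) :
    |∑ c ∈ Finset.range (M + 1), g c * (f c - fpre c)| ≤ 2 * A * B + (B * Lq + A * Ld) * (t M - t 0) := by
  -- the undrifted previous values
  set fp : ℕ → ℝ := fun c => Nat.rec (fpre 0) (fun c _ => f c) c with hfp
  have hfp0 : fp 0 = fpre 0 := rfl
  have hfpS : ∀ c, fp (c + 1) = f c := fun c => rfl
  have hsplit : ∑ c ∈ Finset.range (M + 1), g c * (f c - fpre c) =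
      ∑ c ∈ Finset.range (M + 1), g c * (f c - fp c) + ∑ c ∈ Finset.range (M + 1), g c * (fp c - fpre c) := by
    rw [← Finset.sum_add_distrib]
    exact Finset.sum_congr rfl fun c _ => by ring
  have h1 : |∑ c ∈ Finset.range (M + 1), g c * (f c - fp c)| ≤ 2 * A * B + B * (Lq * (t M - t 0)) := by
    have h := abel_bound g f fp t (fun _ => 0) hB M (fun c _ => hfpS c) hg hf (by rw [hfp0]; exact hfpre0)
      (fun c hc => by rw [add_zero, mul_one]; exact hginc c hc)
    simp only [add_zero, mul_one, Finset.sum_range_sub] at h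
    exact h
  have h2 : |∑ c ∈ Finset.range (M + 1), g c * (fp c - fpre c)| ≤ A * (Ld * (t M - t 0)) := by
    rw [Finset.sum_range_succ', hfp0, sub_self, mul_zero, add_zero]
    calc |∑ c ∈ Finset.range M, g (c + 1) * (fp (c + 1) - fpre (c + 1))|
        ≤ ∑ c ∈ Finset.range M, |g (c + 1) * (fp (c + 1) - fpre (c + 1))| := Finset.abs_sum_le_sum_abs _ _
      _ ≤ ∑ c ∈ Finset.range M, A * (Ld * (t (c + 1) - t c)) := by
          refine Finset.sum_le_sum fun c hc => ?_
          rw [abs_mul, hfpS, abs_sub_comm]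
          exact mul_le_mul (hg _) (hdrift c (Finset.mem_range.1 hc)) (abs_nonneg _) hA
      _ = A * (Ld * (t M - t 0)) := by rw [← Finset.mul_sum, ← Finset.mul_sum, Finset.sum_range_sub]
  rw [hsplit]
  calc _ ≤ _ := abs_add_le _ _
    _ ≤ 2 * A * B + B * (Lq * (t M - t 0)) + A * (Ld * (t M - t 0)) := add_le_add h1 h2
    _ = _ := by ring

/-! ## §3 The bound along one orbit -/

/-- The sup-bound constant of the windowed functional: `C_B = (3/(πr³)) C_h C_S`. [folklore] -/
def CB (r δ K Ch : ℝ) : ℝ := 3 / (Real.pi * r ^ 3) * Ch * CS r δ K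

/-- The first constant of the windowed entropy balance:
`C₁ = 2C_B/r + C_B τ/r² + C_L τ/r`. [folklore] -/
def C1 (r δ K Ch Lh τ : ℝ) : ℝ :=
  2 * r⁻¹ * CB r δ K Ch + CB r δ K Ch * r⁻¹ * r⁻¹ * τ + r⁻¹ * CL r δ K Ch Lh * τ

/-- The second constant of the windowed entropy balance: `C₂ = (3/(πr³)) C_h C_R⁰/(2r)`. [folklore] -/
def C2 (r δ K Ch : ℝ) : ℝ := r⁻¹ * (3 / (Real.pi * r ^ 3)) * Ch * CR0 r δ K / 2

/-- **Step 1 — one collision.** At a collision time of a hard-sphere trajectory on `𝕋³`, the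
ordered-pair sum of the weighted windowed entropic marks is `b (N+1)(𝒮(γ(s⁻)) − 𝒮(γ(s)))` up to
`b (3/(πr³)) C_h C_R⁰/(2(N+1))` times the quartic pair sum (`b ≥ 0` the tent weight). [folklore] -/
theorem collision_step {r δ : ℝ} (hr : 0 < r) (hδ : 0 < δ) (K : ℝ) {h : ℝ → ℝ} {Ch : ℝ}
    (hhb : ∀ a, |h a| ≤ Ch) (hcont : Continuous h) (x₀ : T3) {N : ℕ} {G : Geometry (Fin 3) T3} {ε : ℝ}
    {γ : ℝ → Config (N + 1) (Fin 3) T3} (hγ : IsHardSphereTrajectory G ε (N + 1) γ)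
    (hG : G.IsHardSphereRegular ε) {s : ℝ} (hs : s ∈ collisionTimes G ε γ) {b : ℝ} (hb : 0 ≤ b) :
    |(∑ i, ∑ j, if i ≠ j ∧ ‖G.sepVec (γ s i).1 (γ s j).1‖ = ε then
        b * ∫ x, cone r x x₀ * h (rhoC r (γ s) x) * cone r (γ s i).1 x *
          (LamC r δ K (γ s) x (reflectVel (G.sepVec (γ s i).1 (γ s j).1) ((γ s i).2, (γ s j).2)).1 -
            LamC r δ K (γ s) x (γ s i).2) else 0) -
        b * ((N : ℝ) + 1) * (FS r δ K h x₀ (Function.leftLim γ s) - FS r δ K h x₀ (γ s))| ≤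
      b * (3 / (Real.pi * r ^ 3) * Ch * CR0 r δ K / 2 / ((N : ℝ) + 1)) *
        ∑ i, ∑ j, (if i ≠ j ∧ ‖G.sepVec (γ s i).1 (γ s j).1‖ = ε then
          1 + ‖(γ s i).2‖ ^ 4 + ‖(γ s j).2‖ ^ 4 else 0) := by
  obtain ⟨p, q, hpq, hpos, hvel, hen, -, hQ⟩ := collision_data hγ hG hs
  have hNc : ((N + 1 : ℕ) : ℝ) = (N : ℝ) + 1 := by push_cast; ring
  have hpart := pairSum_eq_particleSum' hγ hG hs (fun i a => b *
    ∫ x, cone r x x₀ * h (rhoC r (γ s) x) * cone r (γ s i).1 x * (LamC r δ K (γ s) x a - LamC r δ K (γ s) x (γ s i).2))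
    (fun i => by simp only [sub_self, mul_zero, integral_zero])
  have hjump := abs_FS_jump_le hr hδ K hhb hcont x₀ hpq hpos hvel hen
  rw [hNc] at hjump
  rw [hpart, hQ, ← Finset.mul_sum, mul_assoc b ((N : ℝ) + 1), ← mul_sub, abs_mul, abs_of_nonneg hb]
  calc b * |(∑ k, ∫ x, cone r x x₀ * h (rhoC r (γ s) x) * cone r (γ s k).1 x *
        (LamC r δ K (γ s) x (Function.leftLim γ s k).2 - LamC r δ K (γ s) x (γ s k).2)) -
        ((N : ℝ) + 1) * (FS r δ K h x₀ (Function.leftLim γ s) - FS r δ K h x₀ (γ s))|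
      ≤ b * (3 / (Real.pi * r ^ 3) * Ch * CR0 r δ K * (1 + ‖(γ s p).2‖ ^ 4 + ‖(γ s q).2‖ ^ 4) / ((N : ℝ) + 1)) :=
        mul_le_mul_of_nonneg_left hjump hb
    _ = _ := by ring

/-- **Step 2 — Abel summation with drift along the enumerated collision times.** Along a hard-sphere
trajectory on `𝕋³` started at `z`, the tent-weighted sum of the jumps of the windowed functional over
the collision times of `[0, τ]` is at most `C₁ (1 + E(z)/(N+1))²`. [folklore] -/
theorem orbit_abel_bound {τ r δ : ℝ} (hτ : 0 < τ) (hr : 0 < r) (hδ : 0 < δ) (K : ℝ) {h : ℝ → ℝ} {Ch Lh : ℝ}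
    (hLh : 0 ≤ Lh) (hhb : ∀ a, |h a| ≤ Ch) (hhL : ∀ a b, |h a - h b| ≤ Lh * |a - b|) (x₀ : T3) (t₀ : ℝ)
    {N : ℕ} {ε : ℝ} (hG : (Torus.geometry (Fin 3)).IsHardSphereRegular ε)
    {γ : ℝ → Config (N + 1) (Fin 3) T3} (hγ : IsHardSphereTrajectory (Torus.geometry (Fin 3)) ε (N + 1) γ)
    {z : Config (N + 1) (Fin 3) T3} (h0 : γ 0 = z)
    (hfin : (collisionTimes (Torus.geometry (Fin 3)) ε γ ∩ Icc 0 τ).Finite) :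
    |∑ s ∈ hfin.toFinset, r⁻¹ * max (1 - |s - t₀| / r) 0 *
        (FS r δ K h x₀ (Function.leftLim γ s) - FS r δ K h x₀ (γ s))| ≤
      C1 r δ K Ch Lh τ * (1 + configEnergy z / (N + 1 : ℝ)) ^ 2 := by
  set G : Geometry (Fin 3) T3 := Torus.geometry (Fin 3) with hG_def
  have hGt : ∀ x : T3, Continuous (G.translate x) := fun x =>
    hG.continuous_translate.comp (continuous_const.prodMk continuous_id)
  have hCh : 0 ≤ Ch := (abs_nonneg _).trans (hhb 0)
  set e := configEnergy z / (N + 1 : ℝ) with he_def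
  have hE0 : 0 ≤ configEnergy z := by unfold configEnergy; positivity
  have he0 : 0 ≤ e := by positivity
  have hEt : ∀ t, configEnergy (γ t) = configEnergy z := fun t => by
    rw [← h0]; exact IsHardSphereTrajectory.configEnergy_eq_holds hγ _ _
  have hCS := (CS_pos hr hδ K).le
  have hCB0 : 0 ≤ CB r δ K Ch := by unfold CB; positivity
  have hCL0 : 0 ≤ CL r δ K Ch Lh := by unfold CL; positivity
  have hC10 : 0 ≤ C1 r δ K Ch Lh τ := by unfold C1; positivity
  set bt : ℝ → ℝ := fun a => r⁻¹ * max (1 - |a| / r) 0 with hbt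
  have hbt0 : ∀ a, 0 ≤ bt a ∧ bt a ≤ r⁻¹ := fun a => tent_nonneg_le hr a
  set FSγ : Config (N + 1) (Fin 3) T3 → ℝ := FS r δ K h x₀ with hFSγ
  show |∑ s ∈ hfin.toFinset, bt (s - t₀) * (FSγ (Function.leftLim γ s) - FSγ (γ s))| ≤ C1 r δ K Ch Lh τ * (1 + e) ^ 2
  by_cases hT : hfin.toFinset.Nonempty
  swap
  · rw [Finset.not_nonempty_iff_eq_empty.1 hT, Finset.sum_empty, abs_zero]; positivity
  have hsmaxT : hfin.toFinset.max' hT ∈ collisionTimes G ε γ ∩ Icc 0 τ := hfin.mem_toFinset.1 (Finset.max'_mem _ hT)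
  obtain ⟨a, ha0, hafree⟩ := hγ.exists_Ioo_left_free 0
  have hasmax : a < hfin.toFinset.max' hT := ha0.trans_le hsmaxT.2.1
  obtain ⟨m, -, hm_mem, hm_mono, hm_surj⟩ := hγ.nthCollisionTime_enum hsmaxT.1 hasmax
  set t := nthCollisionTime G ε γ a with ht_def
  have ht_nonneg : ∀ n, n ≤ m → 0 ≤ t n := fun n hn => by
    by_contra hneg
    exact hafree (t n) ⟨(hm_mem n hn).2.1, lt_of_not_ge hneg⟩ (hm_mem n hn).1
  have ht_le : ∀ n, n ≤ m → t n ≤ τ := fun n hn => (hm_mem n hn).2.2.trans hsmaxT.2.2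
  have ht_lt : ∀ c, c < m → t c < t (c + 1) := fun c hc =>
    hm_mono (Set.mem_Iic.2 hc.le) (Set.mem_Iic.2 (Nat.succ_le_of_lt hc)) c.lt_succ_self
  have ht_free : ∀ c, ∀ u ∈ Ioo (t c) (t (c + 1)), u ∉ collisionTimes G ε γ := fun c u hu =>
    hγ.not_mem_collisionTimes_of_mem_Ioo_nthCollisionTime_succ hu
  have hTimage : hfin.toFinset = (Finset.range (m + 1)).image t := by
    ext u
    rw [hfin.mem_toFinset, Finset.mem_image]
    constructor
    · intro hu
      have hule : u ≤ hfin.toFinset.max' hT := hfin.toFinset.le_max' u (hfin.mem_toFinset.2 hu)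
      obtain ⟨n, hn, hnu⟩ := hm_surj u ⟨hu.1, ha0.trans_le hu.2.1, hule⟩
      exact ⟨n, Finset.mem_range.2 (Nat.lt_succ_of_le hn), hnu⟩
    · rintro ⟨n, hn, rfl⟩
      have hn' : n ≤ m := Nat.le_of_lt_succ (Finset.mem_range.1 hn)
      exact ⟨(hm_mem n hn').1, ht_nonneg n hn', ht_le n hn'⟩
  have hinj : Set.InjOn t ↑(Finset.range (m + 1)) := hm_mono.injOn.mono fun n hn =>
    Set.mem_Iic.2 (Nat.le_of_lt_succ (Finset.mem_range.1 (Finset.mem_coe.1 hn)))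
  have hleft : ∀ c, c < m → Function.leftLim γ (t (c + 1)) = freeFlight G (t (c + 1) - t c) (γ (t c)) :=
    fun c hc => hγ.leftLim_eq_freeFlight hGt (ht_lt c hc) (ht_free c)
  -- the bounds fed to the Abel lemma
  have hB : ∀ c, |FSγ (γ (t c))| ≤ CB r δ K Ch * (1 + e) := fun c => by
    have h1 := abs_FS_le hr hδ K hhb x₀ (γ (t c)) (r := r)
    rw [hEt] at h1
    simpa only [hFSγ, CB, he_def, mul_assoc] using h1
  have hB0 : |FSγ (Function.leftLim γ (t 0))| ≤ CB r δ K Ch * (1 + e) := by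
    obtain ⟨p, q, -, -, -, -, hen, -⟩ := collision_data hγ hG (hm_mem 0 (Nat.zero_le m)).1
    have h1 := abs_FS_le hr hδ K hhb x₀ (Function.leftLim γ (t 0)) (r := r)
    rw [hen, hEt] at h1
    simpa only [hFSγ, CB, he_def, mul_assoc] using h1
  have hdrift : ∀ c, c < m → |FSγ (Function.leftLim γ (t (c + 1))) - FSγ (γ (t c))| ≤
      CL r δ K Ch Lh * (1 + e) ^ 2 * (t (c + 1) - t c) := fun c hc => by
    rw [hleft c hc]
    have h1 := abs_FS_freeFlight_sub_le hr hδ K hLh hhb hhL x₀ (γ (t c)) (t (c + 1) - t c)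
    rwa [hEt, abs_of_nonneg (sub_nonneg.2 (ht_lt c hc).le)] at h1
  have hginc : ∀ c, c < m → |bt (t (c + 1) - t₀) - bt (t c - t₀)| ≤ r⁻¹ * r⁻¹ * (t (c + 1) - t c) := fun c hc => by
    have h1 := abs_tent_sub_tent_le hr (t (c + 1) - t₀) (t c - t₀)
    rw [show t (c + 1) - t₀ - (t c - t₀) = t (c + 1) - t c by ring, abs_of_nonneg (sub_nonneg.2 (ht_lt c hc).le)] at h1
    calc |bt (t (c + 1) - t₀) - bt (t c - t₀)|
        = |r⁻¹ * max (1 - |t (c + 1) - t₀| / r) 0 - r⁻¹ * max (1 - |t c - t₀| / r) 0| := rfl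
      _ ≤ r⁻¹ * ((t (c + 1) - t c) / r) := h1
      _ = r⁻¹ * r⁻¹ * (t (c + 1) - t c) := by ring
  rw [hTimage, Finset.sum_image hinj]
  have habel := abel_drift_bound (fun c => bt (t c - t₀)) (fun c => FSγ (γ (t c)))
    (fun c => FSγ (Function.leftLim γ (t c))) t (A := r⁻¹) (B := CB r δ K Ch * (1 + e)) (Lq := r⁻¹ * r⁻¹)
    (Ld := CL r δ K Ch Lh * (1 + e) ^ 2) (inv_nonneg.2 hr.le) (by positivity) m
    (fun c => (abs_of_nonneg (hbt0 _).1).trans_le (hbt0 _).2) hB hB0 hginc hdrift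
  have hsign : ∑ x ∈ Finset.range (m + 1), bt (t x - t₀) * (FSγ (Function.leftLim γ (t x)) - FSγ (γ (t x))) =
      -∑ c ∈ Finset.range (m + 1), bt (t c - t₀) * (FSγ (γ (t c)) - FSγ (Function.leftLim γ (t c))) := by
    rw [← Finset.sum_neg_distrib]
    exact Finset.sum_congr rfl fun c _ => by ring
  rw [hsign, abs_neg]
  refine habel.trans ?_
  have htm : t m - t 0 ≤ τ := by linarith [ht_le m le_rfl, ht_nonneg 0 (Nat.zero_le m)]
  have ht0m : t 0 ≤ t m := hm_mono.monotoneOn (Set.mem_Iic.2 (Nat.zero_le m)) (Set.mem_Iic.2 le_rfl) (Nat.zero_le m)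
  have htm0 : 0 ≤ t m - t 0 := sub_nonneg.2 ht0m
  have h1e : 1 ≤ 1 + e := by linarith
  have hsq : (1 + e) ≤ (1 + e) ^ 2 := by nlinarith
  have hr' : 0 ≤ r⁻¹ := inv_nonneg.2 hr.le
  calc 2 * r⁻¹ * (CB r δ K Ch * (1 + e)) +
        (CB r δ K Ch * (1 + e) * (r⁻¹ * r⁻¹) + r⁻¹ * (CL r δ K Ch Lh * (1 + e) ^ 2)) * (t m - t 0)
      ≤ 2 * r⁻¹ * (CB r δ K Ch * (1 + e) ^ 2) +
        (CB r δ K Ch * (1 + e) ^ 2 * (r⁻¹ * r⁻¹) + r⁻¹ * (CL r δ K Ch Lh * (1 + e) ^ 2)) * τ := by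
        gcongr
    _ = C1 r δ K Ch Lh τ * (1 + e) ^ 2 := by unfold C1; ring

/-- REGISTERED SUB-GOAL `stub_windowedEntropyBalanceG` of the line `empirical-h-theorem` (crux
stmt-AtomisticToContinuum-15141): Abel summation with drift for a Stieltjes-type sum (restating
`abel_drift_bound` with unit time steps folded into the constants). [folklore] -/
theorem stub_windowedEntropyBalanceG : ∀ (g f fpre t : ℕ → ℝ) (A B Lq Ld : ℝ), 0 ≤ A → 0 ≤ B → ∀ M : ℕ,
    (∀ c, |g c| ≤ A) → (∀ c, |f c| ≤ B) → |fpre 0| ≤ B →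
    (∀ c, c < M → |g (c + 1) - g c| ≤ Lq * (t (c + 1) - t c)) →
    (∀ c, c < M → |fpre (c + 1) - f c| ≤ Ld * (t (c + 1) - t c)) →
    |∑ c ∈ Finset.range (M + 1), g c * (f c - fpre c)| ≤ 2 * A * B + (B * Lq + A * Ld) * (t M - t 0) :=
  fun g f fpre t _ _ _ _ hA hB M hg hf hfpre0 hginc hdrift => abel_drift_bound g f fpre t hA hB M hg hf hfpre0 hginc hdrift

end Summit.AtomisticToContinuum.HydrodynamicLimit.Theorems.ChaosClosesEulerEntropyBalance

end
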